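import Summits.BirchSwinnertonDyer.BirchSwinnertonDyer.Theses.CountingDoorF2AtThree
import Summits.BirchSwinnertonDyer.BirchSwinnertonDyer.Theorems.CountingDoorF2AtThreeDoorFamily
import Summits.BirchSwinnertonDyer.Rank2.CountingDoorKernel
import Summits.BirchSwinnertonDyer.Rank2.CountingDoorTransport
import Summits.BirchSwinnertonDyer.Rank2.F2DensityAlgebra
import Literature.NumberTheory.EllipticCurves.OpenImageMazurAssemblyProofs
import Literature.NumberTheory.EllipticCurves.GlobalMinimalModelProofs
import HarnessLib

/-!
# BirchSwinnertonDyer / CountingDoorF2AtThree — support item `CountingBridge`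
# (stmt-BirchSwinnertonDyer-19551, rev 6; formerly 19484): PROVED — the counting bridge, assembled

Route `route-BirchSwinnertonDyer-CountingDoorF2AtThree` (cell bsd-rank2; TWIN-axis leaf T-r2
`PAdicBSDRankTwoPositiveProportion`, director-bsd ruling 2026-08-26T01:56:50Z). The support item
`CountingBridge` says: the published inputs at `3` (`PublishedInputsAtThree`), the large-family
inputs (`LargeFamilyInputsF2`: Bhargava–Ho Thm. 10.1 and Thm. 9.1), the door kernel
(`DoorKernelAtThree`), generic members (I0 `GenericMembersLargeF2`), the `3`-Selmer average
(I1 `SelmerThreeAverageLargeF2`), root number `+1` with lower density `> 1/6`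
(I2 `RootNumberPlusLowerDensityLargeF2`) and density-one Schneider at `3`
(I4 `SchneiderDensityOneAtThree`) imply the leaf. Proof (memo `HOME/p2/PADIC-R2-G8.md` §3, door
D-count; all ingredients are tree theorems of `Summits/BirchSwinnertonDyer/Rank2/`):

* the family: `Φ₀` of `Theorems/CountingDoorF2AtThreeDoorFamily.lean` (`exists_doorFamily`:
  large, nonempty residues, and member-wise `ρ̄₃` irreducible / good ordinary at `3` /
  multiplicative at `5` with `ord₅ Δ_min = 1` on every globally minimal model);
* the per-member door `countingDoor_leaf_of_member`: `#Sel₃(E_a) = 9`, `rank ≥ 2`, `ρ̄₃`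
  irreducible ⟹ `rank E_a(ℚ) = 2 ∧ Ш(E_a)[3^∞] = 0` (K1,
  `rank_eq_two_and_sha_eq_bot_of_card_selmerGroup_of_irreducible`) ON THE FAMILY'S OWN MODEL,
  Néron's global minimal model `C • E_a` (`hasGlobalMinimalModel_rat_holds`), transport of
  `rank = 2 ∧ Ш[3^∞] = 0` (`rank_two_sha_bot_smul`), Schneider's conjecture from I4's clause at
  `(C, hC)`, then `ord_{T=0} L₃(f, α; T) = 2` by `order_eq_two_at_three_of_rank_two`
  (Skinner–Urban at `3` + Schneider 1985 / Perrin-Riou + Mazur–Tate `σ`, by name from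
  `PublishedInputsAtThree`);
* the bookkeeping `countingDoor_leaf_of_family`: the first-moment method with parity
  (`hasPositiveLowerDensityOn_of_memberwise_bounds`, `F2DensityAlgebra.lean`) with the
  density-ZERO exceptional set ABSORBED into the levels — `Good := (rank ≥ 2) ∧ (I4's Schneider
  clause)` has density one (I0, I4, `hasDensityOn_one_and`); `W := (w = +1) ∨ ¬Good`,
  `G := Leaf ∨ ¬Good`; member-wise `#Sel₃ ≥ 0` (`c_lo = 0`, free), `#Sel₃ ≥ 27` off `W` and
  `#Sel₃ ≥ 81` on `W ∖ G` (K2 `card_selmerGroup_bounds_of_rootNumber`, Dokchitser–Dokchitser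
  `3`-parity, with `#Sel₃ = 9 ⟹ Leaf` from the per-member door); `avg #Sel₃ ≤ 36` (I1),
  `dens W ≥ ρ > 1/6` (I2, which also makes the height balls eventually nonempty), threshold
  `36 < 27 + 54ρ`; hence `G` has positive lower density, and so has `Good ∧ G ⊆ Leaf`
  (`hasPositiveLowerDensityOn_and_of_hasDensityOn_one`).

The hypothesis `DoorKernelAtThree` of the item is not needed on this path (the Selmer count is
done on `E_a`, not on the minimal model; the door runs from `rank = 2 ∧ Ш[3^∞] = 0`), nor is the
torsion clause of I0 (`#E(ℚ)[3] = 1` follows from irreducibility,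
`natCard_torsionBy_eq_one_of_hasIrreducibleModPGaloisRep`); of I0 only `rank ≥ 2` for 100 % is
used. PARTITION: none — r_an ≥ 2, summit axis S0; TWIN (D-0056): n/a. B1 honesty: TWIN currency
only — the order of the cyclotomic `3`-adic `L`-function is read off the algebraic side through the
main conjecture; no analytic rank and no complex `L`-value is mentioned; nothing here is S0 motion.

References: M. Bhargava, A. Shankar, Ann. Math. 181 (2015) §1 (first-moment method with parity)
[BhargavaShankarTernary2015]; M. Bhargava, W. Ho, arXiv:2207.03309 [BhargavaHo2022]; T. and
V. Dokchitser, Ann. Math. 172 (2010) [DokchitserDokchitserAnnals2010]; C. Skinner, E. Urban,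
Invent. Math. 195 (2014) Thm 3.29 [SkinnerUrban2014]; `HOME/p2/PADIC-R2-G8.md` §3.
-/

set_option linter.dupNamespace false

noncomputable section

open scoped Classical
open Filter Topology
open WeierstrassCurve Literature.NumberTheory.EllipticCurves
  Literature.NumberTheory.EllipticCurves.ModularForms CongruenceSubgroup
  Literature.NumberTheory.EllipticCurves.BhargavaHo2022
  Summit.BirchSwinnertonDyer.Rank2
  Summit.BirchSwinnertonDyer.BirchSwinnertonDyer.Theses.CountingDoorF2AtThree

namespace Summit.BirchSwinnertonDyer.BirchSwinnertonDyer.Theorems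

/-- **The leaf's property for ONE counted member.** Modulo the published inputs at `3` (Schneider
1985 / Perrin-Riou, Mazur–Tate `σ`, Skinner–Urban at `p = 3`): a member `E_a` of `F₂` with
`rank E_a(ℚ) ≥ 2`, irreducible `ρ̄₃`, `#Sel₃(E_a) = 9`, whose globally minimal models are good
ordinary at `3` with an auxiliary multiplicative prime `ℓ ≠ 3`, `3 ∤ v_ℓ(Δ_min)`, and satisfy
Schneider's conjecture at `3` in rank two, has a globally minimal model `C • E_a` with
`rank = 2`, `Ш[3^∞] = 0` and `ord_{T=0} L₃(f, α; T) = 2` for every newform `f` (K1 on `E_a`,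
Néron's global minimal model, transport of rank and `Ш[3^∞]`, then the door
`order_eq_two_at_three_of_rank_two`). [cite: SkinnerUrban2014, Thm 3.29] -/
theorem countingDoor_leaf_of_member (h85 : Schneider1985_order_charGenerator_odd)
    (hex : mazur_tate_sigma_exists_odd)
    (hSU : ∀ (W : WeierstrassCurve ℚ) [W.IsElliptic] [W.IsGloballyMinimal]
      (κ : ZpExtension ℚ 3) (γ : Field.absoluteGaloisGroup ℚ) {N : ℕ} [NeZero N]
      (f : CuspForm (Gamma0 N) 2), skinner_urban_main_conjecture W 3 (κ := κ) (γ := γ) (f := f))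
    (a : Params) (ha : a.IsMember)
    (hloc : ∀ (C : VariableChange ℚ) (hC : (C • a.curve).IsGloballyMinimal),
      @IsOrdinaryAt (C • a.curve) hC 3 _ ∧ ∃ ℓ : ℕ, ∃ _ : Fact ℓ.Prime, ℓ ≠ 3 ∧
        (C • a.curve).HasMultiplicativeReductionAtPrime ℓ ∧
        ¬ 3 ∣ padicValInt ℓ (@minimalDiscriminantInt (C • a.curve) hC))
    (h2 : 2 ≤ a.curve.mordellWeilRank) (hirr : a.curve.HasIrreducibleModPGaloisRep 3)
    (hSch : ∀ (C : VariableChange ℚ) (hC : (C • a.curve).IsGloballyMinimal),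
      @IsOrdinaryAt (C • a.curve) hC 3 _ → (C • a.curve).mordellWeilRank = 2 →
      ∀ Dh : PAdicHeightData (C • a.curve) 3, Dh.IsCanonical → SchneiderConjecture Dh)
    (hSel : Nat.card (a.curve.selmerGroup 3) = 3 ^ 2) :
    a.IsMember ∧ ∃ (C : VariableChange ℚ) (hC : (C • a.curve).IsGloballyMinimal),
      @IsOrdinaryAt (C • a.curve) hC 3 _ ∧ (C • a.curve).mordellWeilRank = 2 ∧
      AddCommGroup.primaryComponent (C • a.curve).sha 3 = ⊥ ∧
      ∀ ⦃N : ℕ⦄ [NeZero N] (f : CuspForm (Gamma0 N) 2), IsNewformOf (C • a.curve) f →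
        (padicLFunction f (@unitRoot (C • a.curve) hC 3 _ : ℚ_[3])).order = 2 := by
  haveI : a.curve.IsElliptic := a.isElliptic_curve ha
  obtain ⟨hr, hsha⟩ :=
    rank_eq_two_and_sha_eq_bot_of_card_selmerGroup_of_irreducible a.curve 3 hSel h2 hirr
  obtain ⟨C, hC⟩ := hasGlobalMinimalModel_rat_holds a.curve
  haveI := hC
  obtain ⟨hrC, hshaC⟩ := rank_two_sha_bot_smul a.curve C 3 hr hsha
  obtain ⟨hord, haux⟩ := hloc C hC
  have hirrC : (C • a.curve).HasIrreducibleModPGaloisRep 3 :=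
    (Mazur1978.hasIrreducibleModPGaloisRep_smul_iff a.curve C 3).mpr hirr
  have hR := hSch C hC hord hrC
  exact ⟨ha, C, hC, hord, hrC, hshaC,
    order_eq_two_at_three_of_rank_two h85 hex hSU (C • a.curve) hord hirrC haux hR hrC hshaC⟩

/-- **The counting bridge for a given admissible family.** Let `Φ` be a large subfamily of `F₂`
with a nonempty congruence condition at every prime, every member of which has irreducible `ρ̄₃`
and all its globally minimal models good ordinary at `3` with an auxiliary multiplicative prime
`ℓ ≠ 3`, `3 ∤ v_ℓ(Δ_min)`. Then the published inputs at `3`, `rank ≥ 2` for `100 %` of `Φ` (from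
I0), the `3`-Selmer average `≤ 36` (I1), root number `+1` with lower density `ρ > 1/6` (I2) and
density-one Schneider at `3` (I4) give the leaf ON `Φ`: first-moment method with the density-zero
exceptional set
absorbed into the levels (`c_lo = 0`, `c_mid = 27` off `W = (w = +1) ∨ ¬Good`, `c_hi = 81` on
`W ∖ (Leaf ∨ ¬Good)` by Dokchitser–Dokchitser `3`-parity, K2), threshold `36 < 27 + 54ρ`, then
intersection with the density-one set `Good`. [cite: BhargavaShankarTernary2015, §1 (first-moment method with parity)] -/
theorem countingDoor_leaf_of_family (Φ : CongruenceFamily₂) (hL : Φ.IsLarge)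
    (hne : ∀ p : ℕ, p.Prime → (Φ.residues p).Nonempty)
    (hloc : ∀ a : Params, Φ.Mem a → a.curve.HasIrreducibleModPGaloisRep 3 ∧
      ∀ (C : VariableChange ℚ) (hC : (C • a.curve).IsGloballyMinimal),
        @IsOrdinaryAt (C • a.curve) hC 3 _ ∧ ∃ ℓ : ℕ, ∃ _ : Fact ℓ.Prime, ℓ ≠ 3 ∧
          (C • a.curve).HasMultiplicativeReductionAtPrime ℓ ∧
          ¬ 3 ∣ padicValInt ℓ (@minimalDiscriminantInt (C • a.curve) hC))
    (hIn : PublishedInputsAtThree) (hGen : Φ.HasDensityOn (fun a ↦ 2 ≤ a.curve.mordellWeilRank) 1)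
    (h1 : SelmerThreeAverageLargeF2) (h2 : RootNumberPlusLowerDensityLargeF2)
    (h4 : SchneiderDensityOneAtThree) :
    Φ.HasPositiveLowerDensityOn fun a ↦ a.IsMember ∧
      ∃ (C : WeierstrassCurve.VariableChange ℚ) (hC : (C • a.curve).IsGloballyMinimal),
        @IsOrdinaryAt (C • a.curve) hC 3 _ ∧ (C • a.curve).mordellWeilRank = 2 ∧
        AddCommGroup.primaryComponent (C • a.curve).sha 3 = ⊥ ∧
        ∀ ⦃N : ℕ⦄ [NeZero N] (f : CuspForm (Gamma0 N) 2), IsNewformOf (C • a.curve) f →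
          (padicLFunction f (@unitRoot (C • a.curve) hC 3 _ : ℚ_[3])).order = 2 := by
  obtain ⟨h85, hex, hDD, hSU⟩ := hIn
  have hA := h1 Φ hL
  obtain ⟨ρ, hρ, hW⟩ := h2 Φ hL hne
  have hSchD := h4 Φ hL hne
  have hGood := hasDensityOn_one_and Φ hGen hSchD
  -- the height balls of `Φ` are eventually nonempty (a positive proportion lives in them)
  have hB : ∀ᶠ X : ℕ in atTop, 0 < (Φ.below X).card := by
    refine (hW (ρ / 2) (by linarith)).mono fun X hX ↦ ?_
    by_contra h0
    have hc : (Φ.below X).card = 0 := by omega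
    have hp0 : Φ.proportionOn (fun a ↦ a.curve.rootNumber = 1) X = 0 := by
      rw [proportionOn_eq_card_filter_div, hc, Nat.cast_zero, div_zero]
    linarith
  -- the per-member door, packaged
  have hdoor : ∀ a : Params, Φ.Mem a → 2 ≤ a.curve.mordellWeilRank →
      (∀ (C : WeierstrassCurve.VariableChange ℚ) (hC : (C • a.curve).IsGloballyMinimal),
        @IsOrdinaryAt (C • a.curve) hC 3 _ → (C • a.curve).mordellWeilRank = 2 →
        ∀ Dh : PAdicHeightData (C • a.curve) 3, Dh.IsCanonical → SchneiderConjecture Dh) →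
      Nat.card (a.curve.selmerGroup 3) = 3 ^ 2 →
      (a.IsMember ∧ ∃ (C : WeierstrassCurve.VariableChange ℚ) (hC : (C • a.curve).IsGloballyMinimal),
        @IsOrdinaryAt (C • a.curve) hC 3 _ ∧ (C • a.curve).mordellWeilRank = 2 ∧
        AddCommGroup.primaryComponent (C • a.curve).sha 3 = ⊥ ∧
        ∀ ⦃N : ℕ⦄ [NeZero N] (f : CuspForm (Gamma0 N) 2), IsNewformOf (C • a.curve) f →
          (padicLFunction f (@unitRoot (C • a.curve) hC 3 _ : ℚ_[3])).order = 2) :=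
    fun a hmem hrk hsch hSel ↦ countingDoor_leaf_of_member h85 hex hSU a hmem.1 (hloc a hmem).2
      hrk (hloc a hmem).1 hsch hSel
  -- the first-moment method, exceptional set absorbed into `W` and `G`
  have key := hasPositiveLowerDensityOn_of_memberwise_bounds Φ
    (f := fun a ↦ (Nat.card (a.curve.selmerGroup 3) : ℝ))
    (W := fun a ↦ a.curve.rootNumber = 1 ∨
      ¬ (2 ≤ a.curve.mordellWeilRank ∧
        ∀ (C : WeierstrassCurve.VariableChange ℚ) (hC : (C • a.curve).IsGloballyMinimal),
          @IsOrdinaryAt (C • a.curve) hC 3 _ → (C • a.curve).mordellWeilRank = 2 →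
          ∀ Dh : PAdicHeightData (C • a.curve) 3, Dh.IsCanonical → SchneiderConjecture Dh))
    (G := fun a ↦ (a.IsMember ∧
        ∃ (C : WeierstrassCurve.VariableChange ℚ) (hC : (C • a.curve).IsGloballyMinimal),
          @IsOrdinaryAt (C • a.curve) hC 3 _ ∧ (C • a.curve).mordellWeilRank = 2 ∧
          AddCommGroup.primaryComponent (C • a.curve).sha 3 = ⊥ ∧
          ∀ ⦃N : ℕ⦄ [NeZero N] (f : CuspForm (Gamma0 N) 2), IsNewformOf (C • a.curve) f →
            (padicLFunction f (@unitRoot (C • a.curve) hC 3 _ : ℚ_[3])).order = 2) ∨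
      ¬ (2 ≤ a.curve.mordellWeilRank ∧
        ∀ (C : WeierstrassCurve.VariableChange ℚ) (hC : (C • a.curve).IsGloballyMinimal),
          @IsOrdinaryAt (C • a.curve) hC 3 _ → (C • a.curve).mordellWeilRank = 2 →
          ∀ Dh : PAdicHeightData (C • a.curve) 3, Dh.IsCanonical → SchneiderConjecture Dh))
    (c_lo := 0) (c_mid := 27) (c_hi := 81) (A := 36) (ρ := ρ) (by norm_num) (by norm_num)
    (fun a _ ↦ Nat.cast_nonneg _)
    (by
      intro a hmem hWa
      obtain ⟨hw, hgood⟩ := not_or.mp hWa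
      obtain ⟨hrk, -⟩ := not_not.mp hgood
      haveI : a.curve.IsElliptic := a.isElliptic_curve hmem.1
      have hw' : a.curve.rootNumber = -1 := (rootNumber_eq_one_or a.curve).resolve_left hw
      have ht : Nat.card (AddSubgroup.torsionBy a.curve.toAffine.Point ((3 : ℕ) : ℤ)) = 1 := by
        convert natCard_torsionBy_eq_one_of_hasIrreducibleModPGaloisRep a.curve 3 (hloc a hmem).1
      have h := (card_selmerGroup_bounds_of_rootNumber a.curve 3 hDD hrk ht).1 hw'
      exact_mod_cast h)
    (by
      intro a hmem hWa hGa
      obtain ⟨hleaf, hgood⟩ := not_or.mp hGa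
      obtain ⟨hrk, hsch⟩ := not_not.mp hgood
      have hw : a.curve.rootNumber = 1 := hWa.resolve_right (not_not.mpr ⟨hrk, hsch⟩)
      haveI : a.curve.IsElliptic := a.isElliptic_curve hmem.1
      have ht : Nat.card (AddSubgroup.torsionBy a.curve.toAffine.Point ((3 : ℕ) : ℤ)) = 1 := by
        convert natCard_torsionBy_eq_one_of_hasIrreducibleModPGaloisRep a.curve 3 (hloc a hmem).1
      have hne9 : Nat.card (a.curve.selmerGroup 3) ≠ 3 ^ 2 := fun hSel ↦
        hleaf (hdoor a hmem hrk hsch hSel)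
      have h := (card_selmerGroup_bounds_of_rootNumber a.curve 3 hDD hrk ht).2 hw hne9
      exact_mod_cast h)
    hA (densityOnGE_mono Φ hW fun a h ↦ Or.inl h) hB (by linarith)
  have key2 := hasPositiveLowerDensityOn_and_of_hasDensityOn_one Φ hGood key
  exact hasPositiveLowerDensityOn_mono Φ key2 fun a h ↦ h.2.resolve_right (not_not.mpr h.1)

/-- **`CountingBridge` holds** (stmt-BirchSwinnertonDyer-19551): the published inputs at `3`, the
large-family inputs, the door kernel, generic members (I0), the `3`-Selmer average `≤ 36` (I1),
root number `+1` with lower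
density `> 1/6` (I2) and density-one Schneider at `3` (I4) imply the TWIN leaf
`PAdicBSDRankTwoPositiveProportion`, witnessed by the door family `Φ₀` of `exists_doorFamily`
(`countingDoor_leaf_of_family`). [cite: BhargavaShankarTernary2015, §1 (first-moment method with parity)] -/
theorem countingBridge :
    Summit.BirchSwinnertonDyer.BirchSwinnertonDyer.Theses.CountingDoorF2AtThree.CountingBridge := by
  intro hIn hLF _hK h0 h1 h2 h4
  obtain ⟨Φ, hL, hne, hloc⟩ := exists_doorFamily
  -- the only use of I0 (generic members): `rank ≥ 2` for 100 % of `Φ₀`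
  exact ⟨Φ, hL, countingDoor_leaf_of_family Φ hL hne hloc hIn
    (hasDensityOn_one_mono Φ (h0 hLF Φ hL hne) fun a h ↦ h.2) h1 h2 h4⟩

/-- **The counting door on a given family, LOCAL and PARAMETRIC form** (the reusable kernel of the
bridge for re-typed or `∃ Φ`-forms of the cruxes, and for other constants: route KILL CRITERIA
"with `ρ = 1/2`, `A < 54`"). Let `Φ ⊆ F₂` be any subfamily every member of which has irreducible
`ρ̄₃` and all its globally minimal models good ordinary at `3` with an auxiliary multiplicative prime
`ℓ ≠ 3`, `3 ∤ v_ℓ(Δ_min)`. Suppose, ON `Φ` ONLY: `rank ≥ 2` for `100 %`, `limsup avg #Sel₃ ≤ A`,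
`liminf dens(w = +1) ≥ ρ` with `ρ > 0`, Schneider at `3` for `100 %` of the rank-two minimal
models, and the threshold `A < 27 + 54ρ`. Then, modulo the published inputs at `3`, the leaf's
property has positive lower density in `Φ` (same proof as `countingDoor_leaf_of_family`: levels
`(0, 27, 81)`, exceptional set absorbed into `W`, `G`). [cite: BhargavaShankarTernary2015, §1 (first-moment method with parity)] -/
theorem countingDoor_leaf_of_local (Φ : CongruenceFamily₂)
    (hloc : ∀ a : Params, Φ.Mem a → a.curve.HasIrreducibleModPGaloisRep 3 ∧
      ∀ (C : VariableChange ℚ) (hC : (C • a.curve).IsGloballyMinimal),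
        @IsOrdinaryAt (C • a.curve) hC 3 _ ∧ ∃ ℓ : ℕ, ∃ _ : Fact ℓ.Prime, ℓ ≠ 3 ∧
          (C • a.curve).HasMultiplicativeReductionAtPrime ℓ ∧
          ¬ 3 ∣ padicValInt ℓ (@minimalDiscriminantInt (C • a.curve) hC))
    (hIn : PublishedInputsAtThree) (hGen : Φ.HasDensityOn (fun a ↦ 2 ≤ a.curve.mordellWeilRank) 1)
    {A ρ : ℝ} (hA : Φ.AverageOnLE (fun a ↦ (Nat.card (a.curve.selmerGroup 3) : ℝ)) A)
    (hW : Φ.DensityOnGE (fun a ↦ a.curve.rootNumber = 1) ρ) (hρ : 0 < ρ) (hAρ : A < 27 + 54 * ρ)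
    (hSchD : Φ.HasDensityOn (fun a ↦ ∀ (C : WeierstrassCurve.VariableChange ℚ)
      (hC : (C • a.curve).IsGloballyMinimal), @IsOrdinaryAt (C • a.curve) hC 3 _ →
      (C • a.curve).mordellWeilRank = 2 → ∀ Dh : PAdicHeightData (C • a.curve) 3, Dh.IsCanonical →
      SchneiderConjecture Dh) 1) :
    Φ.HasPositiveLowerDensityOn fun a ↦ a.IsMember ∧
      ∃ (C : WeierstrassCurve.VariableChange ℚ) (hC : (C • a.curve).IsGloballyMinimal),
        @IsOrdinaryAt (C • a.curve) hC 3 _ ∧ (C • a.curve).mordellWeilRank = 2 ∧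
        AddCommGroup.primaryComponent (C • a.curve).sha 3 = ⊥ ∧
        ∀ ⦃N : ℕ⦄ [NeZero N] (f : CuspForm (Gamma0 N) 2), IsNewformOf (C • a.curve) f →
          (padicLFunction f (@unitRoot (C • a.curve) hC 3 _ : ℚ_[3])).order = 2 := by
  obtain ⟨h85, hex, hDD, hSU⟩ := hIn
  have hGood := hasDensityOn_one_and Φ hGen hSchD
  -- the height balls of `Φ` are eventually nonempty (a positive proportion lives in them)
  have hB : ∀ᶠ X : ℕ in atTop, 0 < (Φ.below X).card := by
    refine (hW (ρ / 2) (by linarith)).mono fun X hX ↦ ?_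
    by_contra h0
    have hc : (Φ.below X).card = 0 := by omega
    have hp0 : Φ.proportionOn (fun a ↦ a.curve.rootNumber = 1) X = 0 := by
      rw [proportionOn_eq_card_filter_div, hc, Nat.cast_zero, div_zero]
    linarith
  -- the per-member door, packaged
  have hdoor : ∀ a : Params, Φ.Mem a → 2 ≤ a.curve.mordellWeilRank →
      (∀ (C : WeierstrassCurve.VariableChange ℚ) (hC : (C • a.curve).IsGloballyMinimal),
        @IsOrdinaryAt (C • a.curve) hC 3 _ → (C • a.curve).mordellWeilRank = 2 →
        ∀ Dh : PAdicHeightData (C • a.curve) 3, Dh.IsCanonical → SchneiderConjecture Dh) →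
      Nat.card (a.curve.selmerGroup 3) = 3 ^ 2 →
      (a.IsMember ∧ ∃ (C : WeierstrassCurve.VariableChange ℚ) (hC : (C • a.curve).IsGloballyMinimal),
        @IsOrdinaryAt (C • a.curve) hC 3 _ ∧ (C • a.curve).mordellWeilRank = 2 ∧
        AddCommGroup.primaryComponent (C • a.curve).sha 3 = ⊥ ∧
        ∀ ⦃N : ℕ⦄ [NeZero N] (f : CuspForm (Gamma0 N) 2), IsNewformOf (C • a.curve) f →
          (padicLFunction f (@unitRoot (C • a.curve) hC 3 _ : ℚ_[3])).order = 2) :=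
    fun a hmem hrk hsch hSel ↦ countingDoor_leaf_of_member h85 hex hSU a hmem.1 (hloc a hmem).2
      hrk (hloc a hmem).1 hsch hSel
  -- the first-moment method, exceptional set absorbed into `W` and `G`
  have key := hasPositiveLowerDensityOn_of_memberwise_bounds Φ
    (f := fun a ↦ (Nat.card (a.curve.selmerGroup 3) : ℝ))
    (W := fun a ↦ a.curve.rootNumber = 1 ∨
      ¬ (2 ≤ a.curve.mordellWeilRank ∧
        ∀ (C : WeierstrassCurve.VariableChange ℚ) (hC : (C • a.curve).IsGloballyMinimal),
          @IsOrdinaryAt (C • a.curve) hC 3 _ → (C • a.curve).mordellWeilRank = 2 →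
          ∀ Dh : PAdicHeightData (C • a.curve) 3, Dh.IsCanonical → SchneiderConjecture Dh))
    (G := fun a ↦ (a.IsMember ∧
        ∃ (C : WeierstrassCurve.VariableChange ℚ) (hC : (C • a.curve).IsGloballyMinimal),
          @IsOrdinaryAt (C • a.curve) hC 3 _ ∧ (C • a.curve).mordellWeilRank = 2 ∧
          AddCommGroup.primaryComponent (C • a.curve).sha 3 = ⊥ ∧
          ∀ ⦃N : ℕ⦄ [NeZero N] (f : CuspForm (Gamma0 N) 2), IsNewformOf (C • a.curve) f →
            (padicLFunction f (@unitRoot (C • a.curve) hC 3 _ : ℚ_[3])).order = 2) ∨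
      ¬ (2 ≤ a.curve.mordellWeilRank ∧
        ∀ (C : WeierstrassCurve.VariableChange ℚ) (hC : (C • a.curve).IsGloballyMinimal),
          @IsOrdinaryAt (C • a.curve) hC 3 _ → (C • a.curve).mordellWeilRank = 2 →
          ∀ Dh : PAdicHeightData (C • a.curve) 3, Dh.IsCanonical → SchneiderConjecture Dh))
    (c_lo := 0) (c_mid := 27) (c_hi := 81) (A := A) (ρ := ρ) (by norm_num) (by norm_num)
    (fun a _ ↦ Nat.cast_nonneg _)
    (by
      intro a hmem hWa
      obtain ⟨hw, hgood⟩ := not_or.mp hWa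
      obtain ⟨hrk, -⟩ := not_not.mp hgood
      haveI : a.curve.IsElliptic := a.isElliptic_curve hmem.1
      have hw' : a.curve.rootNumber = -1 := (rootNumber_eq_one_or a.curve).resolve_left hw
      have ht : Nat.card (AddSubgroup.torsionBy a.curve.toAffine.Point ((3 : ℕ) : ℤ)) = 1 := by
        convert natCard_torsionBy_eq_one_of_hasIrreducibleModPGaloisRep a.curve 3 (hloc a hmem).1
      have h := (card_selmerGroup_bounds_of_rootNumber a.curve 3 hDD hrk ht).1 hw'
      exact_mod_cast h)
    (by
      intro a hmem hWa hGa
      obtain ⟨hleaf, hgood⟩ := not_or.mp hGa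
      obtain ⟨hrk, hsch⟩ := not_not.mp hgood
      have hw : a.curve.rootNumber = 1 := hWa.resolve_right (not_not.mpr ⟨hrk, hsch⟩)
      haveI : a.curve.IsElliptic := a.isElliptic_curve hmem.1
      have ht : Nat.card (AddSubgroup.torsionBy a.curve.toAffine.Point ((3 : ℕ) : ℤ)) = 1 := by
        convert natCard_torsionBy_eq_one_of_hasIrreducibleModPGaloisRep a.curve 3 (hloc a hmem).1
      have hne9 : Nat.card (a.curve.selmerGroup 3) ≠ 3 ^ 2 := fun hSel ↦
        hleaf (hdoor a hmem hrk hsch hSel)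
      have h := (card_selmerGroup_bounds_of_rootNumber a.curve 3 hDD hrk ht).2 hw hne9
      exact_mod_cast h)
    hA (densityOnGE_mono Φ hW fun a h ↦ Or.inl h) hB (by linarith)
  have key2 := hasPositiveLowerDensityOn_and_of_hasDensityOn_one Φ hGood key
  exact hasPositiveLowerDensityOn_mono Φ key2 fun a h ↦ h.2.resolve_right (not_not.mpr h.1)

/-- **The leaf on any admissible family from `Φ`-LOCAL crux data** (the `∃ Φ`-form the route's
KILL CRITERIA would pivot to): a large `Φ ⊆ F₂` with member-wise `hirr`/`hord`/`haux` (e.g. the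
door family `Φ₀` of `exists_doorFamily`) on which `rank ≥ 2` holds for `100 %`, the `3`-Selmer
average is `≤ A`, the root number is `+1` with lower density `≥ ρ > 0`, `A < 27 + 54ρ`, and
Schneider at `3` holds for `100 %` of the rank-two minimal models, witnesses
`PAdicBSDRankTwoPositiveProportion` (modulo the published inputs at `3`). [cite: BhargavaShankarTernary2015, §1 (first-moment method with parity)] -/
theorem leaf_of_local (Φ : CongruenceFamily₂) (hL : Φ.IsLarge)
    (hloc : ∀ a : Params, Φ.Mem a → a.curve.HasIrreducibleModPGaloisRep 3 ∧
      ∀ (C : VariableChange ℚ) (hC : (C • a.curve).IsGloballyMinimal),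
        @IsOrdinaryAt (C • a.curve) hC 3 _ ∧ ∃ ℓ : ℕ, ∃ _ : Fact ℓ.Prime, ℓ ≠ 3 ∧
          (C • a.curve).HasMultiplicativeReductionAtPrime ℓ ∧
          ¬ 3 ∣ padicValInt ℓ (@minimalDiscriminantInt (C • a.curve) hC))
    (hIn : PublishedInputsAtThree) (hGen : Φ.HasDensityOn (fun a ↦ 2 ≤ a.curve.mordellWeilRank) 1)
    {A ρ : ℝ} (hA : Φ.AverageOnLE (fun a ↦ (Nat.card (a.curve.selmerGroup 3) : ℝ)) A)
    (hW : Φ.DensityOnGE (fun a ↦ a.curve.rootNumber = 1) ρ) (hρ : 0 < ρ) (hAρ : A < 27 + 54 * ρ)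
    (hSchD : Φ.HasDensityOn (fun a ↦ ∀ (C : WeierstrassCurve.VariableChange ℚ)
      (hC : (C • a.curve).IsGloballyMinimal), @IsOrdinaryAt (C • a.curve) hC 3 _ →
      (C • a.curve).mordellWeilRank = 2 → ∀ Dh : PAdicHeightData (C • a.curve) 3, Dh.IsCanonical →
      SchneiderConjecture Dh) 1) :
    PAdicBSDRankTwoPositiveProportion :=
  ⟨Φ, hL, countingDoor_leaf_of_local Φ hloc hIn hGen hA hW hρ hAρ hSchD⟩

end Summit.BirchSwinnertonDyer.BirchSwinnertonDyer.Theorems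

end
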